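import Summits.AnomalousDissipation.AnomalousDissipation.Theorems.SteadyWeakLimitInjectionWeaklyContinuous
import Literature.Analysis.FluidPDE.DoeringFoiasPowerProofs
import Literature.Analysis.FluidPDE.EulerReynolds
import Literature.Analysis.FunctionSpaces.TorusFourierCalculus
import Literature.Analysis.FunctionSpaces.TorusSpaceTime
import Literature.Analysis.FunctionSpaces.TorusCalculusProofs
import Literature.Analysis.FluidPDE.TorusForceBookkeeping
import Literature.Barriers.NavierStokesRegularity.LionsExponentSharpnessIteration

/-!
# Piece B = `SubviscousDefectAbsorption` (stmt-AnomalousDissipation-18057) at the zero force: the sub-viscous case HOLDS, the O(ν) case FAILS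

`SubviscousDefectAbsorption` specialised to `f = 0`, PROVED: a bounded-energy family of steady classical
states `(u j, p j)` of `NS_{ν j}(fs j)` with a SUB-VISCOUS force, `‖fs j‖_{L²} ≤ δ j · ν j`, `δ j → 0`,
is weakly shadowed by bounded steady classical states of the zero force — namely by its own means
`ū j = ∫ u j` (constant fields, zero pressure, same viscosities):

* steady energy identity `ν j ‖∇u j‖² = ∫ ⟪fs j, u j⟫ ≤ ‖fs j‖₂ ‖u j‖₂ ≤ δ j ν j √E`, so
  `‖∇u j‖² ≤ |δ j| √E → 0` (the sub-viscous calibration is exactly what makes the enstrophy vanish);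
* Poincaré on `T³` (spectral, with the mean removed): `∫ ‖u j - ū j‖² ≤ ‖∇u j‖²`;
* Cauchy–Schwarz: `|∫ ⟪w, ū j - u j⟫| ≤ ‖w‖₂ ‖u j - ū j‖₂ → 0` for smooth `w`;
* constants are steady classical `NS_ν(0)` states with `∫ ‖ū j‖² = ‖ū j‖² ≤ ((1 + E)/2)²`.

With an `O(ν)` defect instead (`‖fs j - f‖₂ ≤ C · ν j`, `C` fixed) the statement is FALSE, proved below as
`not_linearDefectAbsorption`: the laminar calibration `u j = U = cos(2πx₂) e₁` (a Stokes eigenfield,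
`(U·∇)U = 0`, `-Δ U = 4π² U`) is an exact steady `NS_{ν j}` state for the force `4π² ν j · U → 0`, with
energy `½`, and no bounded steady classical states of the zero force shadow it (their enstrophy vanishes
by the energy identity, so they equal their means in `L²`, and `∫ ⟪U, u' j - U⟫ = -½`). Hence the
sub-viscous threshold of B is sharp.
-/

namespace Summit.AnomalousDissipation.AnomalousDissipation.Cruxes.SteadyWeakRealisation.ZeroForce

open MeasureTheory Filter Topology
open scoped InnerProductSpace ENNReal
open Literature.Analysis.FunctionSpaces Literature.Analysis.FunctionSpaces.Torus
open Summit.AnomalousDissipation.AnomalousDissipation.Theorems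

local notation "𝕋³" => UnitAddTorus (Fin 3)
local notation "E³" => EuclideanSpace ℝ (Fin 3)

/-- Constant fields are steady classical Navier–Stokes states of the zero force (zero pressure). -/
theorem isClassicalNSSolutionOn_const (ν : ℝ) (c : E³) :
    IsClassicalNSSolutionOn Set.univ ν (fun _ => fun _ : 𝕋³ => (0 : E³)) (fun _ => fun _ : 𝕋³ => c)
      (fun _ => fun _ : 𝕋³ => (0 : ℝ)) where
  smooth_velocity := isSmoothSpaceTimeOn_const (isSmooth_const c) Set.univ
  smooth_pressure := isSmoothSpaceTimeOn_const (isSmooth_const (0 : ℝ)) Set.univ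
  momentum := by
    intro t _ x
    have h1 : timeDerivWithin Set.univ (fun _ : ℝ => fun _ : 𝕋³ => c) t x = 0 := by
      simp [timeDerivWithin]
    have h2 : convect (fun _ : 𝕋³ => c) (fun _ : 𝕋³ => c) x = 0 := by
      have : liftAt (fun _ : 𝕋³ => c) x = fun _ => c := rfl
      simp [convect, Torus.fderiv, this]
    have h3 : laplacian (fun _ : 𝕋³ => c) x = 0 := by
      unfold laplacian
      have : liftAt (fun _ : 𝕋³ => c) x = fun _ => c := rfl
      rw [this, InnerProductSpace.laplacian_eq_iteratedFDeriv_stdOrthonormalBasis]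
      simp [iteratedFDeriv_const_of_ne (𝕜 := ℝ) (n := 2) (by norm_num) c]
    have h4 : gradient (fun _ : 𝕋³ => (0 : ℝ)) x = 0 :=
      Literature.Analysis.FluidPDE.Torus.gradient_zero x
    rw [h1, h2, h3, h4]
    simp
  divFree := by
    intro t _ x
    simp [divergence, partialDeriv, Torus.lineDeriv]

/-- `‖∫ u‖ ≤ (1 + ∫ ‖u‖²) / 2` on the probability torus (`2‖u‖ ≤ 1 + ‖u‖²` pointwise). -/
theorem norm_integral_le {u : 𝕋³ → E³} (hu : IsSmooth u) :
    ‖∫ x, u x‖ ≤ (1 + ∫ x, ‖u x‖ ^ 2) / 2 := by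
  have h1 : ‖∫ x, u x‖ ≤ ∫ x, ‖u x‖ := norm_integral_le_integral_norm _
  have h2 : ∫ x, ‖u x‖ ≤ ∫ x, (1 + ‖u x‖ ^ 2) / 2 := by
    refine integral_mono hu.continuous.norm.integrable_unitAddTorus ?_ fun x => ?_
    · exact (Integrable.add (integrable_const (1 : ℝ)) hu.norm_sq.integrable).div_const 2
    · have : 0 ≤ (‖u x‖ - 1) ^ 2 := sq_nonneg _
      nlinarith
  have h3 : ∫ x, (1 + ‖u x‖ ^ 2) / 2 = (1 + ∫ x, ‖u x‖ ^ 2) / 2 := by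
    rw [integral_div, integral_add (integrable_const _) hu.norm_sq.integrable, integral_const]
    simp
  linarith

/-- **Poincaré with the mean removed, for smooth fields on `T³`:** `∫ ‖u - ū‖² ≤ ‖∇u‖²`
(spectral Poincaré `4π² ‖v‖₂² ≤ ‖∇v‖₂² + 4π² ‖∫ v‖²` at `v = u - ū`, and `4π² ≥ 1`). -/
theorem integral_norm_sub_mean_sq_le {u : 𝕋³ → E³} (hu : IsSmooth u) :
    ∫ x, ‖u x - ∫ y, u y‖ ^ 2 ≤ gradNormSq u := by
  set c : E³ := ∫ y, u y with hc
  have hv : IsSmooth (fun x => u x - c) := hu.sub (isSmooth_const c)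
  -- the recentred field has zero mean
  have hmean : ∫ x, (u x - c) = 0 := by
    rw [integral_sub hu.integrable (integrable_const c), integral_const]
    simp [hc]
  -- its gradient norm is that of `u`
  have hgrad : gradNormSq (fun x => u x - c) = gradNormSq u := by
    unfold gradNormSq
    refine integral_congr_ae (ae_of_all _ fun x => ?_)
    refine Finset.sum_congr rfl fun i _ => ?_
    show ‖partialDeriv i (fun x => u x - c) x‖ ^ 2 = ‖partialDeriv i u x‖ ^ 2
    congr 2
    show deriv (fun t : ℝ => u (x + proj (t • EuclideanSpace.single i (1 : ℝ))) - c) 0 =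
      deriv (fun t : ℝ => u (x + proj (t • EuclideanSpace.single i (1 : ℝ)))) 0
    exact deriv_sub_const _
  -- spectral Poincaré
  have hP := Literature.Analysis.FluidPDE.ofReal_integral_norm_sq_le_eGradNormSq_add (hv.memLp 2)
  rw [hmean, norm_zero, zero_pow two_ne_zero, mul_zero, ENNReal.ofReal_zero, add_zero,
    eGradNormSq_eq_ofReal_gradNormSq hv, hgrad,
    ENNReal.ofReal_le_ofReal_iff (gradNormSq_nonneg u)] at hP
  have hpi : (1 : ℝ) ≤ 4 * Real.pi ^ 2 := by nlinarith [Real.pi_gt_three]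
  have h0 : 0 ≤ ∫ x, ‖u x - c‖ ^ 2 := integral_nonneg fun _ => sq_nonneg _
  nlinarith

/-- **`SubviscousDefectAbsorption` at the zero force (BC5 special case of item stmt-18057), proved.**
The statement is the route decl with `f := fun _ => 0` (its three hypotheses on `f` become trivial and
are dropped): shadow by the means `ū j`, at the same viscosities, along `φ = id`. -/
theorem subviscousDefectAbsorption_zero_force :
    ∀ (ν δ : ℕ → ℝ) (fs u : ℕ → 𝕋³ → E³) (p : ℕ → 𝕋³ → ℝ) (E : ℝ), (∀ j, 0 < ν j) →
      Tendsto ν atTop (𝓝 0) → (∀ j, IsSmooth (fs j) ∧ IsDivFree (fs j) ∧ HasZeroMean (fs j)) →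
      Tendsto δ atTop (𝓝 0) →
      (∀ j, eLpNorm (fs j - fun _ => (0 : E³)) 2 volume ≤ ENNReal.ofReal (δ j * ν j)) →
      (∀ j, IsClassicalNSSolutionOn Set.univ (ν j) (fun _ => fs j) (fun _ => u j) (fun _ => p j)) →
      (∀ j, ∫ x, ‖u j x‖ ^ 2 ≤ E) →
      ∃ (φ : ℕ → ℕ) (ν' : ℕ → ℝ) (u' : ℕ → 𝕋³ → E³) (p' : ℕ → 𝕋³ → ℝ) (E' : ℝ), StrictMono φ ∧
        (∀ j, 0 < ν' j) ∧ Tendsto ν' atTop (𝓝 0) ∧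
        (∀ j, IsClassicalNSSolutionOn Set.univ (ν' j) (fun _ => fun _ : 𝕋³ => (0 : E³)) (fun _ => u' j)
          (fun _ => p' j)) ∧
        (∀ j, ∫ x, ‖u' j x‖ ^ 2 ≤ E') ∧
        ∀ w : 𝕋³ → E³, IsSmooth w → Tendsto (fun j => ∫ x, ⟪w x, u' j x - u (φ j) x⟫_ℝ) atTop (𝓝 0) := by
  intro ν δ fs u p E hν hν0 hfs hδ hdef hNS hE
  have hu : ∀ j, IsSmooth (u j) := fun j =>
    (hNS j).smooth_velocity.isSmooth_slice (Set.mem_univ (0 : ℝ))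
  -- energies are nonnegative, so `0 ≤ E`
  have hE0 : 0 ≤ E := (integral_nonneg fun _ => sq_nonneg _).trans (hE 0)
  -- the means
  set c : ℕ → E³ := fun j => ∫ x, u j x with hc
  refine ⟨id, ν, fun j _ => c j, fun _ _ => 0, ((1 + E) / 2) ^ 2, strictMono_id, hν, hν0,
    fun j => isClassicalNSSolutionOn_const (ν j) (c j), fun j => ?_, fun w hw => ?_⟩
  · -- energy of the constant shadow
    have h1 : ‖c j‖ ≤ (1 + E) / 2 :=
      (norm_integral_le (hu j)).trans (by linarith [hE j])
    have h2 : (∫ x, ‖(fun _ : 𝕋³ => c j) x‖ ^ 2) = ‖c j‖ ^ 2 := by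
      rw [integral_const]; simp
    rw [h2]
    exact pow_le_pow_left₀ (norm_nonneg _) h1 2
  · -- the enstrophy vanishes: `‖∇u j‖² ≤ |δ j| √E`
    have hgrad : ∀ j, gradNormSq (u j) ≤ |δ j| * Real.sqrt E := by
      intro j
      have hid := steadyWeakLimit_steady_energy_identity (hNS j)
      have hfs0 : fs j - (fun _ => (0 : E³)) = fs j := by funext x; simp
      have hdef' : (eLpNorm (fs j) 2 volume).toReal ≤ |δ j| * ν j := by
        refine ENNReal.toReal_le_of_le_ofReal (mul_nonneg (abs_nonneg _) (hν j).le) ?_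
        rw [← hfs0]
        exact (hdef j).trans (ENNReal.ofReal_le_ofReal
          (mul_le_mul_of_nonneg_right (le_abs_self _) (hν j).le))
      have hcs := steadyWeakLimit_abs_integral_inner_le ((hfs j).1.memLp 2) ((hu j).memLp 2)
      have hsq := steadyWeakLimit_toReal_eLpNorm_le_sqrt ((hu j).memLp 2) (hE j)
      have h1 : ν j * gradNormSq (u j) ≤ |δ j| * ν j * Real.sqrt E := by
        rw [hid]
        refine (le_abs_self _).trans (hcs.trans ?_)
        exact mul_le_mul hdef' hsq ENNReal.toReal_nonneg (mul_nonneg (abs_nonneg _) (hν j).le)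
      have h2 : ν j * gradNormSq (u j) ≤ ν j * (|δ j| * Real.sqrt E) := by nlinarith
      exact le_of_mul_le_mul_left h2 (hν j)
    -- Cauchy–Schwarz: `|∫ ⟪w, c j - u j⟫| ≤ ‖w‖₂ · √(|δ j| √E)`
    have hbound : ∀ j, |∫ x, ⟪w x, c j - u j x⟫_ℝ| ≤
        (eLpNorm w 2 volume).toReal * Real.sqrt (|δ j| * Real.sqrt E) := by
      intro j
      have hv : IsSmooth (fun x => c j - u j x) := (isSmooth_const (c j)).sub (hu j)
      have hcs := steadyWeakLimit_abs_integral_inner_le (hw.memLp 2) (hv.memLp 2)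
      have hP : ∫ x, ‖c j - u j x‖ ^ 2 ≤ |δ j| * Real.sqrt E := by
        have h := integral_norm_sub_mean_sq_le (hu j)
        have e : ∀ x, ‖c j - u j x‖ = ‖u j x - c j‖ := fun x => norm_sub_rev _ _
        simp_rw [e]
        exact h.trans (hgrad j)
      have hsq := steadyWeakLimit_toReal_eLpNorm_le_sqrt (hv.memLp 2) hP
      exact hcs.trans (mul_le_mul_of_nonneg_left hsq ENNReal.toReal_nonneg)
    -- the majorant tends to zero
    have hlim : Tendsto (fun j => (eLpNorm w 2 volume).toReal * Real.sqrt (|δ j| * Real.sqrt E))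
        atTop (𝓝 0) := by
      have h1 : Tendsto (fun j => |δ j| * Real.sqrt E) atTop (𝓝 0) := by
        simpa using (continuous_abs.tendsto 0 |>.comp hδ).mul_const (Real.sqrt E)
      have h2 : Tendsto (fun j => Real.sqrt (|δ j| * Real.sqrt E)) atTop (𝓝 0) := by
        have h := (Real.continuous_sqrt.tendsto 0).comp h1
        rw [Real.sqrt_zero] at h
        exact h
      simpa using h2.const_mul ((eLpNorm w 2 volume).toReal)
    refine squeeze_zero_norm (fun j => ?_) hlim
    rw [Real.norm_eq_abs]
    exact hbound j

/-! ## Sharpness: absorption of `O(ν)` force defects fails (laminar Stokes-eigenfield calibration) -/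

/-- `realTrigPoly` commutes with real scalars in the coefficients (adapted from
`Torus.realTrigPoly_smul`, TorusWeightedGalerkinCoefficients). -/
theorem realTrigPoly_smul_aux (S : Finset (Fin 3 → ℤ)) (a : ℝ) (c : (Fin 3 → ℤ) → EuclideanSpace ℂ (Fin 3)) :
    realTrigPoly S (a • c) = a • realTrigPoly S c := by
  have h : a • c = (a : ℂ) • c := by
    funext k; simp only [Pi.smul_apply, Complex.coe_smul]
  funext x
  rw [Pi.smul_apply, realTrigPoly_apply, realTrigPoly_apply, h, trigPoly_smul, Pi.smul_apply,
    Complex.coe_smul, map_smul]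

open Literature.Barriers.NavierStokesRegularity.LuoTiti2020 in
/-- `Δ U = -4π² U` for the shear Stokes eigenfield `U = cos(2πx₂) e₁`. -/
theorem laplacian_shearField (x : 𝕋³) :
    laplacian shearField x = (-(4 * Real.pi ^ 2)) • shearField x := by
  have h := laplacian_realTrigPoly shearModes shearCoeff x
  have hcoef : ∀ k ∈ shearModes,
      -((((4 * Real.pi ^ 2 * freqNormSq k : ℝ)) : ℂ) • shearCoeff k) =
        ((-(4 * Real.pi ^ 2) : ℝ) • shearCoeff) k := by
    intro k hk
    have hk1 : freqNormSq k = 1 := by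
      simp only [shearModes, Finset.mem_insert, Finset.mem_singleton] at hk
      rcases hk with rfl | rfl <;> simp [freqNormSq, shearFreq, Fin.sum_univ_three]
    rw [hk1, mul_one, Pi.smul_apply, ← Complex.coe_smul, ← neg_smul]
    push_cast
    ring_nf
  rw [shearField] at *
  rw [h, realTrigPoly_congr hcoef, realTrigPoly_smul_aux]
  rfl

open Literature.Barriers.NavierStokesRegularity.LuoTiti2020 in
/-- **Laminar calibration**: the fixed shear field `U` is an exact steady classical `NS_ν` state for the
force `(4π² ν) • U` (zero pressure): `(U·∇)U = 0` and `ν Δ U + 4π² ν U = 0`. -/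
theorem isClassicalNSSolutionOn_shearField (ν : ℝ) :
    IsClassicalNSSolutionOn Set.univ ν (fun _ => (4 * Real.pi ^ 2 * ν) • shearField) (fun _ => shearField)
      (fun _ => fun _ : 𝕋³ => (0 : ℝ)) where
  smooth_velocity := isSmoothSpaceTimeOn_const isSmooth_shearField Set.univ
  smooth_pressure := isSmoothSpaceTimeOn_const (isSmooth_const (0 : ℝ)) Set.univ
  momentum := by
    intro t _ x
    have h1 : timeDerivWithin Set.univ (fun _ : ℝ => shearField) t x = 0 := by
      simp [timeDerivWithin]
    have h4 : gradient (fun _ : 𝕋³ => (0 : ℝ)) x = 0 :=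
      Literature.Analysis.FluidPDE.Torus.gradient_zero x
    rw [h1, convect_shearField_self x, laplacian_shearField x, h4, Pi.smul_apply, smul_smul, sub_zero,
      add_zero, ← add_smul]
    ring_nf
    simp
  divFree := fun _ _ => isDivFree_shearField

open Literature.Barriers.NavierStokesRegularity.LuoTiti2020 in
/-- **The O(ν) variant of `SubviscousDefectAbsorption` is FALSE.** Replacing the sub-viscous defect
`‖fs j - f‖₂ ≤ δ j · ν j`, `δ j → 0`, by a linear one `‖fs j - f‖₂ ≤ C · ν j` (fixed `C`) makes the
absorption statement refutable: `f = 0`, `u j = U` the shear Stokes eigenfield, `fs j = 4π² ν j · U`,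
`ν j = 1/(j+1)`, `C = 4π²`, `E = ½`; every steady classical state of the zero force has zero enstrophy
(energy identity), hence equals its mean in `L²` (Poincaré) and pairs to `0` with the mean-zero `U`, so
`∫ ⟪U, u' j - U⟫ = -½ ↛ 0`. -/
theorem not_linearDefectAbsorption :
    ¬ ∀ (f : 𝕋³ → E³) (ν : ℕ → ℝ) (C : ℝ) (fs u : ℕ → 𝕋³ → E³) (p : ℕ → 𝕋³ → ℝ) (E : ℝ),
      IsSmooth f → IsDivFree f → HasZeroMean f → (∀ j, 0 < ν j) → Tendsto ν atTop (𝓝 0) →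
      (∀ j, IsSmooth (fs j) ∧ IsDivFree (fs j) ∧ HasZeroMean (fs j)) →
      (∀ j, eLpNorm (fs j - f) 2 volume ≤ ENNReal.ofReal (C * ν j)) →
      (∀ j, IsClassicalNSSolutionOn Set.univ (ν j) (fun _ => fs j) (fun _ => u j) (fun _ => p j)) →
      (∀ j, ∫ x, ‖u j x‖ ^ 2 ≤ E) →
      ∃ (φ : ℕ → ℕ) (ν' : ℕ → ℝ) (u' : ℕ → 𝕋³ → E³) (p' : ℕ → 𝕋³ → ℝ) (E' : ℝ), StrictMono φ ∧
        (∀ j, 0 < ν' j) ∧ Tendsto ν' atTop (𝓝 0) ∧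
        (∀ j, IsClassicalNSSolutionOn Set.univ (ν' j) (fun _ => f) (fun _ => u' j) (fun _ => p' j)) ∧
        (∀ j, ∫ x, ‖u' j x‖ ^ 2 ≤ E') ∧
        ∀ w : 𝕋³ → E³, IsSmooth w → Tendsto (fun j => ∫ x, ⟪w x, u' j x - u (φ j) x⟫_ℝ) atTop (𝓝 0) := by
  intro h
  -- the witness family
  set U : 𝕋³ → E³ := shearField with hUdef
  have hU : IsSmooth U := isSmooth_shearField
  set ν : ℕ → ℝ := fun j => 1 / ((j : ℝ) + 1) with hν
  have hνpos : ∀ j, 0 < ν j := fun j => by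
    rw [hν]; positivity
  have hν0 : Tendsto ν atTop (𝓝 0) := tendsto_one_div_add_atTop_nhds_zero_nat
  set fs : ℕ → 𝕋³ → E³ := fun j => (4 * Real.pi ^ 2 * ν j) • U with hfs
  have hf0 : IsSmooth (fun _ : 𝕋³ => (0 : E³)) := isSmooth_const _
  have hdf0 : IsDivFree (fun _ : 𝕋³ => (0 : E³)) := fun x =>
    Literature.Analysis.FluidPDE.Torus.divergence_zero x
  have hmf0 : HasZeroMean (fun _ : 𝕋³ => (0 : E³)) := by simp [HasZeroMean]
  have hfsP : ∀ j, IsSmooth (fs j) ∧ IsDivFree (fs j) ∧ HasZeroMean (fs j) := fun j =>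
    ⟨hU.smul _, Literature.Analysis.FluidPDE.Torus.isDivFree_const_smul (hU.isContDiff (by simp))
      isDivFree_shearField _,
      Literature.Analysis.FluidPDE.Torus.hasZeroMean_const_smul integral_shearField _⟩
  -- `‖U‖₂ ≤ 1`
  have hU1 : eLpNorm U 2 volume ≤ 1 := by
    have hE1 : ∫ x, ‖U x‖ ^ 2 ≤ 1 := by rw [hUdef, integral_norm_sq_shearField]; norm_num
    have ht := steadyWeakLimit_toReal_eLpNorm_le_sqrt (hU.memLp 2) hE1
    rw [Real.sqrt_one] at ht
    rw [← ENNReal.ofReal_toReal (hU.memLp 2).eLpNorm_ne_top]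
    exact ENNReal.ofReal_le_one.2 ht
  have hdef : ∀ j, eLpNorm (fs j - fun _ => (0 : E³)) 2 volume ≤
      ENNReal.ofReal (4 * Real.pi ^ 2 * ν j) := by
    intro j
    have e : (fs j - fun _ => (0 : E³)) = (4 * Real.pi ^ 2 * ν j) • U := by
      funext x; simp [hfs]
    rw [e, eLpNorm_const_smul, Real.enorm_eq_ofReal (by positivity : (0 : ℝ) ≤ 4 * Real.pi ^ 2 * ν j)]
    calc ENNReal.ofReal (4 * Real.pi ^ 2 * ν j) * eLpNorm U 2 volume
        ≤ ENNReal.ofReal (4 * Real.pi ^ 2 * ν j) * 1 := mul_le_mul_right hU1 _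
      _ = ENNReal.ofReal (4 * Real.pi ^ 2 * ν j) := mul_one _
  have hNS : ∀ j, IsClassicalNSSolutionOn Set.univ (ν j) (fun _ => fs j) (fun _ => U)
      (fun _ => fun _ : 𝕋³ => (0 : ℝ)) := fun j => isClassicalNSSolutionOn_shearField (ν j)
  have hE : ∀ j : ℕ, ∫ x, ‖U x‖ ^ 2 ≤ 1 / 2 := fun _ => by
    rw [hUdef, integral_norm_sq_shearField]
  obtain ⟨φ, ν', u', p', E', _hφ, hν', _hν'0, hNS', _hE', hsh⟩ :=
    h (fun _ => 0) ν (4 * Real.pi ^ 2) fs (fun _ => U) (fun _ => fun _ => 0) (1 / 2) hf0 hdf0 hmf0 hνpos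
      hν0 hfsP hdef hNS hE
  -- every steady classical state of the zero force pairs to zero with `U`
  have hu' : ∀ j, IsSmooth (u' j) := fun j =>
    (hNS' j).smooth_velocity.isSmooth_slice (Set.mem_univ (0 : ℝ))
  have hpair : ∀ j, ∫ x, ⟪U x, u' j x⟫_ℝ = 0 := by
    intro j
    -- zero enstrophy
    have hid := steadyWeakLimit_steady_energy_identity (hNS' j)
    have hg0 : gradNormSq (u' j) = 0 := by
      have : ν' j * gradNormSq (u' j) = 0 := by rw [hid]; simp
      rcases mul_eq_zero.1 this with h1 | h1
      · exact absurd h1 (hν' j).ne'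
      · exact h1
    -- `u' j` equals its mean in `L²`
    set c : E³ := ∫ y, u' j y with hc
    have hdev : ∫ x, ‖u' j x - c‖ ^ 2 ≤ 0 := by
      have := integral_norm_sub_mean_sq_le (hu' j)
      rw [hg0] at this
      exact this
    have hv : IsSmooth (fun x => u' j x - c) := (hu' j).sub (isSmooth_const c)
    have hcs := steadyWeakLimit_abs_integral_inner_le (hU.memLp 2) (hv.memLp 2)
    have hsq := steadyWeakLimit_toReal_eLpNorm_le_sqrt (hv.memLp 2) hdev
    rw [Real.sqrt_zero] at hsq
    have h0 : ∫ x, ⟪U x, u' j x - c⟫_ℝ = 0 := by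
      have : |∫ x, ⟪U x, u' j x - c⟫_ℝ| ≤ 0 := by
        refine hcs.trans ?_
        have := mul_le_mul_of_nonneg_left hsq (ENNReal.toReal_nonneg : 0 ≤ (eLpNorm U 2 volume).toReal)
        simpa using this
      exact abs_nonpos_iff.1 this
    -- the mean pairs to zero with the mean-zero `U`
    have h1 : ∫ x, ⟪U x, c⟫_ℝ = 0 := by
      simp_rw [real_inner_comm c]
      rw [integral_inner hU.integrable c, show (∫ x, U x) = 0 from integral_shearField, inner_zero_right]
    -- split
    have hsplit : ∫ x, ⟪U x, u' j x⟫_ℝ = (∫ x, ⟪U x, u' j x - c⟫_ℝ) + ∫ x, ⟪U x, c⟫_ℝ := by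
      rw [← integral_add (hU.inner hv).integrable (hU.inner (isSmooth_const c)).integrable]
      refine integral_congr_ae (ae_of_all _ fun x => ?_)
      show ⟪U x, u' j x⟫_ℝ = ⟪U x, u' j x - c⟫_ℝ + ⟪U x, c⟫_ℝ
      rw [inner_sub_right]; ring
    rw [hsplit, h0, h1, add_zero]
  -- hence the shadowing pairing is constantly `-1/2`
  have hconst : ∀ j, ∫ x, ⟪U x, u' j x - U x⟫_ℝ = -(1 / 2) := by
    intro j
    have hsplit : ∫ x, ⟪U x, u' j x - U x⟫_ℝ = (∫ x, ⟪U x, u' j x⟫_ℝ) - ∫ x, ⟪U x, U x⟫_ℝ := by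
      rw [← integral_sub (hU.inner (hu' j)).integrable (hU.inner hU).integrable]
      refine integral_congr_ae (ae_of_all _ fun x => ?_)
      exact inner_sub_right _ _ _
    have hself : ∫ x, ⟪U x, U x⟫_ℝ = 1 / 2 := by
      simp_rw [real_inner_self_eq_norm_sq]
      rw [hUdef, integral_norm_sq_shearField]
    rw [hsplit, hpair j, hself]
    ring
  have hlim := hsh U hU
  rw [show (fun j => ∫ x, ⟪U x, u' j x - (fun _ : ℕ => U) (φ j) x⟫_ℝ) = fun _ => (-(1 / 2) : ℝ) from
    funext fun j => hconst j] at hlim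
  have := tendsto_nhds_unique (tendsto_const_nhds (x := (-(1 / 2) : ℝ))) hlim
  norm_num at this

end Summit.AnomalousDissipation.AnomalousDissipation.Cruxes.SteadyWeakRealisation.ZeroForce
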